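import Summits.Schanuel.Schanuel.Theorems.ZilberEacGraphFibreCurveComplete
import Summits.Schanuel.Schanuel.Theorems.ZilberEacGraphConstFibreAlgebraic
import Literature.ModelTheory.Zilber.EACDensityNonFree
import HarnessLib

/-!
# Arbitrary base branches, LXXXVI: MANTOVA–MASSER'S QUESTION HAS A POSITIVE ANSWER FOR EVERY
# SURFACE OVER A POLYNOMIAL GRAPH OVER `ℚ̄` OF DEGREE ≥ 2

HONEST FRAMING.  Cell `pub-schanuel` (Zilber's Exponential-Algebraic Closedness, case ladder;
host summit Schanuel), seat 2, gen 32.  Gen 26 (`mmCase_graphBase_complete`, file LXXIII of the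
equimodular class) proved: a surface of Mantova–Masser's case over `x₁ = p(x₀)`, `deg p ≥ 2`, WITHOUT
Zariski-dense exponential points is a constant-fibre cylinder `{x₁ = p(x₀)} × {P₂(y₀) = 0}`.  File
LXXXV (`unprojectedDensityQuestion_graph_constFibre_algebraic`, Lindemann) proved: for
`p ∈ ℚ̄[x]` of degree `≥ 2` every constant fibre `{x₁ = p(x₀), y₀ = θ}`, `θ ≠ 0`, IS dense.  Hence
(`unprojectedDense_of_mmCase_graphBase_algebraic`): **every surface `W` of Mantova–Masser's case
(dim-π-S-1-free) whose additive projection closure is a polynomial graph `x₁ = p(x₀)` with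
`p ∈ ℚ̄[x]`, `deg p ≥ 2`, has Zariski-dense unprojected exponential points** — the question is
answered YES for this entire class, with no further hypothesis on `W`.

What this is NOT: transcendental coefficients (`{x₁ = x₀²/(2πi), y₀ = 1}` is NOT dense, seat 1
gen 9 — the hypothesis `p ∈ ℚ̄[x]` is sharp in this sense); other base curves (files LXXXIII–LXXXIV
decide polynomial / rational fibres over every curve over `ℚ̄`, not yet every surface); Fib(3,2);
EC(3,2) — OPEN; Mantova–Masser's question OPEN in general; NOT Schanuel's conjecture (neither used
nor implied; Lindemann's theorem is used); EAC ⇏ SC.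
-/

noncomputable section

open Filter Topology Set Complex MvPolynomial
open Literature.NumberTheory.Transcendental Literature.ModelTheory.Zilber
open Literature.ModelTheory.ExponentialFields

set_option linter.dupNamespace false

namespace Summit.Schanuel.Schanuel.Theorems

section GraphBaseComplete

variable (p : Polynomial ℂ)

/-- A polynomial supported on `{v | v 0 = 0}` does not depend on the first variable. [folklore] -/
theorem eval_eq_eval_of_support_fst_eq_zero (P₂ : MvPolynomial (Fin 2) ℂ)
    (hsupp : ∀ v ∈ P₂.support, v 0 = 0) (a b y : ℂ) :
    MvPolynomial.eval ![a, y] P₂ = MvPolynomial.eval ![b, y] P₂ := by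
  classical
  rw [MvPolynomial.eval_eq', MvPolynomial.eval_eq']
  refine Finset.sum_congr rfl fun v hv => ?_
  simp only [Fin.prod_univ_two, Matrix.cons_val_zero, Matrix.cons_val_one, hsupp v hv, pow_zero,
    one_mul]

/-- **Mantova–Masser's question over polynomial graphs over `ℚ̄`: YES for every surface.**  `W` in
the case (dim-π-S-1-free) with `cl π(W ∩ G²) = {x₁ = p(x₀)}`, `p ∈ ℚ̄[x]`, `deg p ≥ 2` ⟹ the
unprojected exponential points of `W` are Zariski dense. [cite: MantovaMasser2023, §1 Further
remarks, p. 5 (the question, open in general)] (new) -/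
theorem unprojectedDense_of_mmCase_graphBase_algebraic (hd : 2 ≤ p.natDegree)
    (halg : ∀ i, IsAlgebraic ℚ (p.coeff i)) {W : Set (Fin 2 ⊕ Fin 2 → ℂ)}
    (hmm : MMCaseDimPiOneFree W)
    (hbase : zeroLocus ℂ (vanishingIdeal ℂ (projAdd '' (W ∩ torusLocus ℂ 2))) =
      {x : Fin 2 → ℂ | x 1 = p.eval (x 0)}) :
    UnprojectedDense W := by
  classical
  by_contra hnot
  obtain ⟨P₂, -, hW, hsupp⟩ := mmCase_graphBase_complete p hd hmm hbase hnot
  obtain ⟨w, hwW, hwT⟩ := hmm.2.1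
  set θ : ℂ := w (Sum.inr 0) with hθ
  have hθ0 : θ ≠ 0 := (mem_torusLocus_iff.1 hwT) 0
  have hwP : MvPolynomial.eval ![w (Sum.inl 0), θ] P₂ = 0 := by
    have h := hwW
    rw [hW] at h
    exact h.2
  have hZ := unprojectedDensityQuestion_graph_constFibre_algebraic p hd halg hθ0
  have hsub : {z : Fin 2 ⊕ Fin 2 → ℂ | z (Sum.inl 1) = p.eval (z (Sum.inl 0)) ∧ z (Sum.inr 0) = θ}
      ⊆ W := by
    intro z hz
    rw [hW]
    refine ⟨hz.1, ?_⟩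
    rw [hz.2, eval_eq_eval_of_support_fst_eq_zero P₂ hsupp (z (Sum.inl 0)) (w (Sum.inl 0)) θ]
    exact hwP
  have hZW := eq_of_subset_of_zariskiDim_eq hZ.1.1.1 hmm.1 hsub hZ.1.2.2.1 hmm.2.2.1
  rw [← hZW] at hnot
  exact hnot hZ.2

/-- **Equivalently: over polynomial graphs over `ℚ̄` of degree `≥ 2`, case ⟹ dense** (the shape of
Mantova–Masser's question, restricted to this class of additive projections).
[cite: MantovaMasser2023, §1 Further remarks, p. 5 (the question, open in general)] (new) -/
theorem unprojectedDensityQuestion_graphBase_algebraic (hd : 2 ≤ p.natDegree)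
    (halg : ∀ i, IsAlgebraic ℚ (p.coeff i)) :
    ∀ W : Set (Fin 2 ⊕ Fin 2 → ℂ), MMCaseDimPiOneFree W →
      zeroLocus ℂ (vanishingIdeal ℂ (projAdd '' (W ∩ torusLocus ℂ 2))) =
        {x : Fin 2 → ℂ | x 1 = p.eval (x 0)} → UnprojectedDense W :=
  fun _ hmm hbase => unprojectedDense_of_mmCase_graphBase_algebraic p hd halg hmm hbase

/-- **Rational coefficients.** [cite: MantovaMasser2023, §1 Further remarks, p. 5 (the question,
open in general)] (new) -/
theorem unprojectedDense_of_mmCase_graphBase_ratCoeff (hd : 2 ≤ p.natDegree)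
    (hrat : ∀ i, ∃ q : ℚ, p.coeff i = (q : ℂ)) {W : Set (Fin 2 ⊕ Fin 2 → ℂ)}
    (hmm : MMCaseDimPiOneFree W)
    (hbase : zeroLocus ℂ (vanishingIdeal ℂ (projAdd '' (W ∩ torusLocus ℂ 2))) =
      {x : Fin 2 → ℂ | x 1 = p.eval (x 0)}) :
    UnprojectedDense W := by
  refine unprojectedDense_of_mmCase_graphBase_algebraic p hd (fun i => ?_) hmm hbase
  obtain ⟨q, hq⟩ := hrat i
  rw [hq]
  exact isAlgebraic_algebraMap (q : ℚ)

/-- **Example: every surface of the case over the parabola `x₁ = x₀²` is dense** (over `x₁ = x₀²`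
the constant fibre `y₀ = 1` is dense, whereas over `x₁ = x₀²/(2πi)` it is not — seat 1 gen 9).
[cite: MantovaMasser2023, §1 Further remarks, p. 5] (new) -/
theorem unprojectedDense_of_mmCase_parabolaBase {W : Set (Fin 2 ⊕ Fin 2 → ℂ)}
    (hmm : MMCaseDimPiOneFree W)
    (hbase : zeroLocus ℂ (vanishingIdeal ℂ (projAdd '' (W ∩ torusLocus ℂ 2))) =
      {x : Fin 2 → ℂ | x 1 = x 0 ^ 2}) :
    UnprojectedDense W := by
  refine unprojectedDense_of_mmCase_graphBase_ratCoeff (Polynomial.X ^ 2) (by simp) (fun i => ?_)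
    hmm (by rw [hbase]; ext x; simp)
  refine ⟨if i = 2 then 1 else 0, ?_⟩
  rw [Polynomial.coeff_X_pow]
  split_ifs <;> simp

end GraphBaseComplete

end Summit.Schanuel.Schanuel.Theorems
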